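import Summits.BirchSwinnertonDyer.BirchSwinnertonDyer.Theorems.CyclotomicUntwistPSUntwistedTraceFrobenius
import Literature.NumberTheory.EllipticCurves.TateModuleBaseChange
import Literature.NumberTheory.EllipticCurves.GoodReductionUnramifiedProofs
import Literature.NumberTheory.EllipticCurves.TateModuleContinuityProofs
import Literature.NumberTheory.GaloisRepresentations.AbsIntegersEquiv
import Literature.NumberTheory.GaloisRepresentations.AbsGaloisOuterConj
import Literature.NumberTheory.GaloisRepresentations.AbsGaloisRestrictCyclotomic
import Literature.NumberTheory.GaloisRepresentations.ModNCyclotomicCharacter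
import Literature.NumberTheory.EllipticCurves.HasseWeilGoodReductionFrobenius
import Literature.NumberTheory.EllipticCurves.HasseWeilAbelianLSeriesProofs
import Literature.NumberTheory.GaloisRepresentations.IntegralGaloisActionProofs
import Literature.NumberTheory.GaloisRepresentations.FramedRepTwistEulerFactorProofs
import HarnessLib

/-!
# Principal-series rows at `3`: the inertia at `3` acts on `V_ℓ(W)` through `Gal(ℚ(ζ₉)/ℚ)`
# (the elements of `I_𝔓` fixing `ζ₉` act trivially) — print layer (T) of crux child C1, file 2a

Cell `pub/bsd-wall` (D-0145 line `route-BirchSwinnertonDyer-CyclotomicUntwist`), seat `bsd-line-cycu-p1`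
(K1/K2 LEAD lineage, gen 8). THEOREMS ONLY (no definition, no named fact, no `sorry`); helper toward the
crux child C1 = stmt-BirchSwinnertonDyer-27548 through the print layer (T) «`a₃(g₀)` is a root of
`X² − a_w(W)X + 3`» (memo `Cruxes/PSRankOneLowerHalfAtThree/LAW-La3-KERNEL-v3.md` §9). BSD is not proved by
this file; no crux and no child of the route is proved by it.

WHAT. For `W/ℚ` on a principal-series row at `3` (`ClassO6 W 3`, `v₃(Δ_min)` even, unit part `≡ 1 (mod 3)`)
the curve acquires good reduction over `F = ℚ(ζ₉)` at the place above `3` (tree theorem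
`GNineFrobeniusTrace.hasGoodReductionAt_baseChange_of_psRow`, cycu-p3). Hence, for a prime `ℓ ≠ 3`, a
prime `𝔓` of `ℤ̄` above `3` and `i ∈ I_𝔓` with trivial mod-`9` cyclotomic character (`i` fixes `ζ₉`):
**`i` acts trivially on the rational Tate module `V_ℓ(W)`**
(`rationalGaloisRepTate_apply_eq_self_of_mem_inertia_of_modNCyclotomicCharacter_eq_one`). Proof: `i` fixes
the copy of `F` in `ℚ̄`, so `i = res(i')` for `i' ∈ Γ_F` (`mem_range_absGaloisRestrict_iff_smul_absEmbedding`,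
`forall_smul_absEmbedding_eq_iff_of_isPrimitiveRoot`); `i'` lies in the inertia group of the prime `𝔔` of
`ℤ̄_F` corresponding to `𝔓` (`comap_inertia_comap_absIntegersMap`), which lies over a place `w ∣ 3` of `F`
(`exists_heightOneSpectrum_of_comap_absIntegersMap_mem_primesAbove`); `V_ℓ(W ×_ℚ F)` is unramified at `w`
(`isUnramifiedAt_rationalTateGaloisRepOf_geomPoints`, good reduction, `w ∤ ℓ`); and
`V_ℓ(W)|_{Γ_F} ≅ V_ℓ(W ×_ℚ F)` (`rationalTateModuleEquiv_rationalGaloisRepTate`). Consequence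
(`rationalGaloisRepTate_eq_pow_of_mem_inertia`): for `τ ∈ I_𝔓` with `χ₉(τ) = 2` (a generator of
`(ℤ/9)ˣ`), every `i ∈ I_𝔓` acts on `V_ℓ(W)` as a power of `τ`; such a `τ` exists
(`exists_mem_inertia_modNCyclotomicCharacter_nine_eq`: `I_𝔓 ↠ (ℤ/9)ˣ`, `3` is totally ramified in `ℚ(ζ₉)`,
tree `exists_mem_inertia_modNCyclotomicCharacter_eq`); and (`exists_isArithFrobAt_charpoly_rationalGaloisRepTate`)
there is an ARITHMETIC FROBENIUS `σ` at `𝔓` FIXING `ζ₉` whose characteristic polynomial on `V_ℓ(W)` is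
`X² − a_w(W)·X + 3`, `a_w(W) = W.psUntwistedTrace` (restriction of a Frobenius of `Γ_F` at the prime `𝔔 ∣ 𝔓`;
good-reduction characteristic polynomial `hasFrobCharpolyAt_rationalTateGaloisRepOf_of_hasGoodReductionAt` of
`W ×_ℚ F` at `w`, `a_w = frobeniusTraceAt (W ×_ℚ F) w = psUntwistedTrace W` by the tree theorem
`frobeniusTraceAt_baseChange_eq_psUntwistedTrace` (cycu-p3, p626097), `#k_w = 3`). These are exactly the
Galois-side inputs «cyclic inertia through `τ`», «fixed vector» (next file: the choice of `η`) and «`charpoly(ρ σ)`»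
of `CoinvariantEigenvalue.isRoot_charpoly_of_charpoly_reverse_toInertiaCoinvariants_eq` (file 1, p646654) for
LAW (T).

References: [cite: SilvermanAEC2009, Prop. VII.4.1 and VII.5.4 (good reduction ⇒ unramified; semistable
reduction theorem)] · [cite: SerreTate1968, §1–§2] · [cite: NeukirchANT1999, Ch. I (10.1), Ch. II (9.6)].
-/

set_option autoImplicit false
-- single-conjunct summit: `Summit.BirchSwinnertonDyer.BirchSwinnertonDyer.…` repeats the name by design
set_option linter.dupNamespace false

noncomputable section

open scoped NumberField
open Polynomial NumberField IsDedekindDomain Field IsCyclotomicExtension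
  Literature.NumberTheory.GaloisRepresentations Literature.NumberTheory.EllipticCurves
  Summit.BirchSwinnertonDyer.Rank1Residual.Additive

namespace Summit.BirchSwinnertonDyer.BirchSwinnertonDyer.Theorems.InertiaOverCyclotomicNine

variable (W : WeierstrassCurve ℚ) [W.IsElliptic] [W.IsGloballyMinimal]

/-- At a place `v ∣ 3` of `ℚ`: the prime under `v` is `3`. [folklore] -/
theorem natGenerator_eq_three {v : HeightOneSpectrum (𝓞 ℚ)} (hv : (3 : 𝓞 ℚ) ∈ v.asIdeal) :
    Rat.HeightOneSpectrum.natGenerator v = 3 := by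
  have hdvd : Rat.HeightOneSpectrum.natGenerator v ∣ 3 := by
    rw [Rat.HeightOneSpectrum.natGenerator_dvd_iff, Ideal.mem_map_of_equiv]
    exact ⟨3, hv, map_ofNat _ 3⟩
  exact (Nat.prime_dvd_prime_iff_eq (Rat.HeightOneSpectrum.prime_natGenerator v) Nat.prime_three).mp hdvd

/-- Bookkeeping over a ninth cyclotomic field `F`: a prime `𝔓 ∣ 3` of `ℤ̄` is the contraction of a prime `𝔔`
of `ℤ̄_F` lying over a place `w ∣ 3` of `F` (along the tree's `absIntegersMap ℚ F : ℤ̄ → ℤ̄_F`, bijective).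
[cite: NeukirchANT1999, Ch. I §9] -/
theorem exists_prime_absIntegers_over_three (F : Type) [Field F] [NumberField F]
    [IsCyclotomicExtension {9} ℚ F]
    {v : HeightOneSpectrum (𝓞 ℚ)} (hv : (3 : 𝓞 ℚ) ∈ v.asIdeal)
    {𝔓 : Ideal (absIntegers (𝓞 ℚ) ℚ)} (h𝔓 : 𝔓 ∈ v.primesAbove) :
    ∃ (𝔔 : Ideal (absIntegers (𝓞 F) F)) (_ : 𝔔.IsPrime) (w : HeightOneSpectrum (𝓞 F)),
      𝔔.comap (absIntegersMap ℚ F) = 𝔓 ∧ 𝔔 ∈ w.primesAbove ∧ (3 : 𝓞 F) ∈ w.asIdeal ∧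
        w.residueCard = 3 ∧ v.residueCard = 3 := by
  classical
  haveI : 𝔓.IsPrime := h𝔓.1
  let 𝔔 : Ideal (absIntegers (𝓞 F) F) := 𝔓.comap (absIntegersEquiv ℚ F).symm.toRingHom
  have h𝔔𝔓 : 𝔔.comap (absIntegersMap ℚ F) = 𝔓 := by
    ext x
    simp only [𝔔, Ideal.mem_comap, RingEquiv.toRingHom_eq_coe, RingHom.coe_coe]
    rw [← absIntegersEquiv_apply, RingEquiv.symm_apply_apply]
  haveI h𝔔p : 𝔔.IsPrime := Ideal.comap_isPrime _ _
  obtain ⟨w, hwv, h𝔔w, -⟩ :=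
    exists_heightOneSpectrum_of_comap_absIntegersMap_mem_primesAbove (K := ℚ) (M := F)
      (v := v) (𝔔 := 𝔔) (by rw [h𝔔𝔓]; exact h𝔓)
  have hw3 : (3 : 𝓞 F) ∈ w.asIdeal := by
    have h : algebraMap (𝓞 ℚ) (𝓞 F) 3 ∈ w.asIdeal := by
      rw [← Ideal.mem_comap]
      change (3 : 𝓞 ℚ) ∈ w.asIdeal.under (𝓞 ℚ)
      rw [hwv]; exact hv
    rwa [map_ofNat] at h
  refine ⟨𝔔, h𝔔p, w, h𝔔𝔓, h𝔔w, hw3, ?_, ?_⟩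
  · -- `k_w = 𝔽₃` (`𝔭_w = (ζ₉ − 1)`, `N(ζ₉ − 1) = 3`)
    haveI : IsCyclotomicExtension {3 ^ (1 + 1)} ℚ F := by
      rw [show ((3 : ℕ) ^ (1 + 1) : ℕ) = 9 by norm_num]; infer_instance
    rw [w.residueCard_eq_card_quotient]
    exact GNineFrobeniusTrace.natCard_quotient_eq_three w hw3
  · rw [FramedRep.residueCard_eq_coe_primesEquiv' v]
    exact natGenerator_eq_three hv

/-- **On a principal-series row, an element of the inertia group at `3` that fixes `ζ₉` acts trivially on
`V_ℓ(W)`, `ℓ ≠ 3`** (good reduction of `W` over `F ∋ ζ₉` above `3`, Néron–Ogg–Shafarevich, transported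
along `V_ℓ(W)|_{Γ_F} ≅ V_ℓ(W ×_ℚ F)`); auxiliary form with the `9`-th cyclotomic field `F` explicit.
[cite: SilvermanAEC2009, Prop. VII.4.1] [cite: SerreTate1968, §1] -/
theorem rationalGaloisRepTate_apply_eq_self_of_mem_inertia_aux
    (F : Type) [Field F] [NumberField F] [IsCyclotomicExtension {9} ℚ F]
    (hO6 : ClassO6 W 3) (hev : Even (padicValInt 3 W.minimalDiscriminantInt))
    (hsq : W.minimalDiscriminantInt / 3 ^ padicValInt 3 W.minimalDiscriminantInt % 3 = 1)
    (ℓ : ℕ) [Fact ℓ.Prime] (hℓ : ℓ ≠ 3)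
    {v : HeightOneSpectrum (𝓞 ℚ)} (hv : (3 : 𝓞 ℚ) ∈ v.asIdeal)
    {𝔓 : Ideal (absIntegers (𝓞 ℚ) ℚ)} (h𝔓 : 𝔓 ∈ v.primesAbove)
    {i : absoluteGaloisGroup ℚ} (hi : i ∈ 𝔓.inertia (absoluteGaloisGroup ℚ))
    (hχ : modNCyclotomicCharacter ℚ 9 i = 1) (x : W.rationalTateModule ℓ) :
    W.rationalGaloisRepTate ℓ i x = x := by
  classical
  haveI : NeZero ((9 : ℕ) : ℚ) := ⟨by norm_num⟩
  haveI : Fact (1 < 9) := ⟨by norm_num⟩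
  have hζ := IsCyclotomicExtension.zeta_spec 9 ℚ F
  -- `i` fixes the copy of `F = ℚ(ζ₉)` in `ℚ̄`, hence lies in the image of `Γ_F`
  have hrange : i ∈ (absGaloisRestrict ℚ F).range := by
    rw [mem_range_absGaloisRestrict_iff_smul_absEmbedding,
      forall_smul_absEmbedding_eq_iff_of_isPrimitiveRoot ℚ F hζ i]
    have h9 : (absEmbedding ℚ F (zeta 9 ℚ F)) ^ 9 = 1 := by
      rw [← map_pow, hζ.pow_eq_one, map_one]
    rw [modNCyclotomicCharacter_spec ℚ 9 i _ h9, hχ, Units.val_one, ZMod.val_one, pow_one]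
  obtain ⟨i', rfl⟩ := hrange
  -- the prime `𝔔` of `ℤ̄_F` corresponding to `𝔓`, over a place `w ∣ 3` of `F`
  obtain ⟨𝔔, _, w, h𝔔𝔓, h𝔔w, hw3, -, -⟩ := exists_prime_absIntegers_over_three F hv h𝔓
  -- `i'` is in the inertia group of `𝔔`
  have hi' : i' ∈ 𝔔.inertia (absoluteGaloisGroup F) := by
    rw [← comap_inertia_comap_absIntegersMap ℚ F 𝔔, Subgroup.mem_comap, h𝔔𝔓]
    exact hi
  have hℓw : (ℓ : 𝓞 F) ∉ w.asIdeal := by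
    intro hmem
    have hcop : Nat.Coprime ℓ 3 := (Nat.coprime_primes Fact.out Nat.prime_three).mpr hℓ
    obtain ⟨a, b, hab⟩ := Nat.Coprime.isCoprime hcop
    apply w.isPrime.ne_top
    rw [Ideal.eq_top_iff_one]
    have h1 : (a : 𝓞 F) * (ℓ : 𝓞 F) + (b : 𝓞 F) * (3 : 𝓞 F) ∈ w.asIdeal :=
      w.asIdeal.add_mem (w.asIdeal.mul_mem_left _ hmem) (w.asIdeal.mul_mem_left _ hw3)
    have h2 : (a : 𝓞 F) * (ℓ : 𝓞 F) + (b : 𝓞 F) * (3 : 𝓞 F) = 1 := by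
      have h := congrArg (Int.cast : ℤ → 𝓞 F) hab
      push_cast at h
      exact h
    rwa [h2] at h1
  -- good reduction of `W ×_ℚ F` at `w`, hence `V_ℓ(W ×_ℚ F)` is unramified at `w`
  have hgood := GNineFrobeniusTrace.hasGoodReductionAt_baseChange_of_psRow W hO6 hev hsq F w hw3
  have hcF := (W.baseChange F).continuous_rationalGaloisRepTate_holds ℓ
  have hunr := (W.baseChange F).isUnramifiedAt_rationalTateGaloisRepOf_geomPoints ℓ hcF hgood hℓw
  have htriv : (W.baseChange F).rationalGaloisRepTate ℓ i' = 1 := hunr 𝔔 h𝔔w i' hi'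
  -- transport along `V_ℓ(W)|_{Γ_F} ≅ V_ℓ(W ×_ℚ F)`
  apply (rationalTateModuleEquiv W F ℓ).injective
  change rationalTateModuleEquiv W F ℓ (W.rationalGaloisRepTate ℓ (absGaloisRestrict ℚ F i') x) = _
  rw [rationalTateModuleEquiv_rationalGaloisRepTate W F ℓ i' x, htriv, Module.End.one_apply]

/-- **On a principal-series row, an element of the inertia group at `3` that fixes `ζ₉` acts trivially on
`V_ℓ(W)`, `ℓ ≠ 3`** — the auxiliary field specialised to `F = CyclotomicField 9 ℚ`.
[cite: SilvermanAEC2009, Prop. VII.4.1] [cite: SerreTate1968, §1] -/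
theorem rationalGaloisRepTate_apply_eq_self_of_mem_inertia_of_modNCyclotomicCharacter_eq_one
    (hO6 : ClassO6 W 3) (hev : Even (padicValInt 3 W.minimalDiscriminantInt))
    (hsq : W.minimalDiscriminantInt / 3 ^ padicValInt 3 W.minimalDiscriminantInt % 3 = 1)
    (ℓ : ℕ) [Fact ℓ.Prime] (hℓ : ℓ ≠ 3)
    {v : HeightOneSpectrum (𝓞 ℚ)} (hv : (3 : 𝓞 ℚ) ∈ v.asIdeal)
    {𝔓 : Ideal (absIntegers (𝓞 ℚ) ℚ)} (h𝔓 : 𝔓 ∈ v.primesAbove)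
    {i : absoluteGaloisGroup ℚ} (hi : i ∈ 𝔓.inertia (absoluteGaloisGroup ℚ))
    (hχ : modNCyclotomicCharacter ℚ 9 i = 1) (x : W.rationalTateModule ℓ) :
    W.rationalGaloisRepTate ℓ i x = x := by
  haveI : NeZero ((9 : ℕ) : ℚ) := ⟨by norm_num⟩
  -- `IsCyclotomicExtension {9} ℚ (CyclotomicField 9 ℚ)` is keyed on `CyclotomicField.algebra`; the statement
  -- over a number field uses the canonical `ℚ`-algebra structure (the two agree: `Subsingleton.elim`).
  haveI hcyc : IsCyclotomicExtension {9} ℚ (CyclotomicField 9 ℚ) := by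
    have h : (CyclotomicField.algebra 9 ℚ : Algebra ℚ (CyclotomicField 9 ℚ)) =
        DivisionRing.toRatAlgebra :=
      Subsingleton.elim _ _
    exact h ▸ CyclotomicField.isCyclotomicExtension 9 ℚ
  haveI : NumberField (CyclotomicField 9 ℚ) := IsCyclotomicExtension.numberField {9} ℚ _
  exact rationalGaloisRepTate_apply_eq_self_of_mem_inertia_aux W (CyclotomicField 9 ℚ) hO6 hev hsq ℓ hℓ
    hv h𝔓 hi hχ x

/-- **The inertia group at `3` surjects onto `Gal(ℚ(ζ₉)/ℚ) ≅ (ℤ/9)ˣ`** (`3` is totally ramified in `ℚ(ζ₉)`;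
tree `exists_mem_inertia_modNCyclotomicCharacter_eq`): every unit mod `9` is the mod-`9` cyclotomic
character of some `τ ∈ I_𝔓`, `𝔓 ∣ 3`. [cite: NeukirchANT1999, Ch. I (10.1) and Ch. II (9.6)] -/
theorem exists_mem_inertia_modNCyclotomicCharacter_nine_eq {v : HeightOneSpectrum (𝓞 ℚ)}
    (hv : (3 : 𝓞 ℚ) ∈ v.asIdeal) {𝔓 : Ideal (absIntegers (𝓞 ℚ) ℚ)} (h𝔓 : 𝔓 ∈ v.primesAbove)
    (u : (ZMod 9)ˣ) :
    ∃ τ ∈ 𝔓.inertia (absoluteGaloisGroup ℚ), modNCyclotomicCharacter ℚ 9 τ = u := by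
  haveI : Fact (Nat.Prime 3) := ⟨Nat.prime_three⟩
  exact exists_mem_inertia_modNCyclotomicCharacter_eq (m := 9) (p := 3) (k := 1) (d := 1) (by norm_num)
    (by norm_num) (natGenerator_eq_three hv) h𝔓 (a := u) (Subsingleton.elim _ _)

/-- `2` generates `(ℤ/9)ˣ`: every unit mod `9` is a power `2^j`, `j < 6`. [folklore] -/
theorem exists_coe_eq_two_pow (u : (ZMod 9)ˣ) : ∃ j : Fin 6, (u : ZMod 9) = 2 ^ (j : ℕ) := by
  revert u
  decide

/-- **On a principal-series row the inertia at `3` acts on `V_ℓ(W)` through the cyclic group generated by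
one `τ ∈ I_𝔓` with `χ₉(τ) = 2`**: every `i ∈ I_𝔓` acts as `ρ(τ)^j` (`χ₉(i) = 2^j`, and `τ^{-j} i` fixes
`ζ₉`, hence acts trivially). [cite: SilvermanAEC2009, Prop. VII.4.1] [cite: NeukirchANT1999, Ch. I (10.1)] -/
theorem rationalGaloisRepTate_eq_pow_of_mem_inertia
    (hO6 : ClassO6 W 3) (hev : Even (padicValInt 3 W.minimalDiscriminantInt))
    (hsq : W.minimalDiscriminantInt / 3 ^ padicValInt 3 W.minimalDiscriminantInt % 3 = 1)
    (ℓ : ℕ) [Fact ℓ.Prime] (hℓ : ℓ ≠ 3)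
    {v : HeightOneSpectrum (𝓞 ℚ)} (hv : (3 : 𝓞 ℚ) ∈ v.asIdeal)
    {𝔓 : Ideal (absIntegers (𝓞 ℚ) ℚ)} (h𝔓 : 𝔓 ∈ v.primesAbove)
    {τ : absoluteGaloisGroup ℚ} (hτ : τ ∈ 𝔓.inertia (absoluteGaloisGroup ℚ))
    (hχτ : (modNCyclotomicCharacter ℚ 9 τ : ZMod 9) = 2)
    {i : absoluteGaloisGroup ℚ} (hi : i ∈ 𝔓.inertia (absoluteGaloisGroup ℚ)) :
    ∃ j : ℕ, W.rationalGaloisRepTate ℓ i = W.rationalGaloisRepTate ℓ τ ^ j := by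
  obtain ⟨j, hj⟩ := exists_coe_eq_two_pow (modNCyclotomicCharacter ℚ 9 i)
  refine ⟨j, ?_⟩
  -- `h := (τ^j)⁻¹ * i` lies in `I_𝔓` and fixes `ζ₉`
  set h : absoluteGaloisGroup ℚ := (τ ^ (j : ℕ))⁻¹ * i with hh
  have hhI : h ∈ 𝔓.inertia (absoluteGaloisGroup ℚ) :=
    Subgroup.mul_mem _ (Subgroup.inv_mem _ (Subgroup.pow_mem _ hτ _)) hi
  have hχh : modNCyclotomicCharacter ℚ 9 h = 1 := by
    apply Units.ext
    have h1 : ((modNCyclotomicCharacter ℚ 9 (τ ^ (j : ℕ)) : (ZMod 9)ˣ) : ZMod 9) = 2 ^ (j : ℕ) := by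
      rw [map_pow, Units.val_pow_eq_pow_val, hχτ]
    rw [hh, map_mul, map_inv, Units.val_mul, Units.val_one, hj, ← h1, Units.inv_mul]
  have htriv : W.rationalGaloisRepTate ℓ h = 1 := LinearMap.ext fun x =>
    rationalGaloisRepTate_apply_eq_self_of_mem_inertia_of_modNCyclotomicCharacter_eq_one W hO6 hev hsq ℓ
      hℓ hv h𝔓 hhI hχh x
  have hi_eq : i = τ ^ (j : ℕ) * h := by rw [hh, mul_inv_cancel_left]
  rw [hi_eq, map_mul, htriv, mul_one, map_pow]

/-- **An arithmetic Frobenius at `𝔓 ∣ 3` fixing `ζ₉`, with characteristic polynomial `X² − a_w(W)X + 3` on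
`V_ℓ(W)`**, on a principal-series row (auxiliary form, `F ∋ ζ₉` explicit): take an arithmetic Frobenius `σ'` of
`Γ_F` at the prime `𝔔 ∣ w ∣ 3` of `ℤ̄_F` over `𝔓`; `σ = res(σ')` is an arithmetic Frobenius at `𝔓` (both residue
fields are `𝔽₃`), fixes `ζ₉`, and acts on `V_ℓ(W) ≅ V_ℓ(W ×_ℚ F)` with the good-reduction characteristic
polynomial `X² − a_w X + #k_w` (`hasFrobCharpolyAt_rationalTateGaloisRepOf_of_hasGoodReductionAt`), where
`a_w = frobeniusTraceAt (W ×_ℚ F) w = psUntwistedTrace W` (tree, cycu-p3) and `#k_w = 3`.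
[cite: SilvermanAEC2009, V.2.3.1 and C.§16] [cite: SerreTate1968, §1] -/
theorem exists_isArithFrobAt_charpoly_rationalGaloisRepTate_aux
    (F : Type) [Field F] [NumberField F] [IsCyclotomicExtension {9} ℚ F]
    (hO6 : ClassO6 W 3) (hev : Even (padicValInt 3 W.minimalDiscriminantInt))
    (hsq : W.minimalDiscriminantInt / 3 ^ padicValInt 3 W.minimalDiscriminantInt % 3 = 1)
    (ℓ : ℕ) [Fact ℓ.Prime] (hℓ : ℓ ≠ 3) [Module.Finite ℚ_[ℓ] (W.rationalTateModule ℓ)]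
    {v : HeightOneSpectrum (𝓞 ℚ)} (hv : (3 : 𝓞 ℚ) ∈ v.asIdeal)
    {𝔓 : Ideal (absIntegers (𝓞 ℚ) ℚ)} (h𝔓 : 𝔓 ∈ v.primesAbove) :
    ∃ σ : absoluteGaloisGroup ℚ, IsArithFrobAt (𝓞 ℚ) σ 𝔓 ∧ modNCyclotomicCharacter ℚ 9 σ = 1 ∧
      (W.rationalGaloisRepTate ℓ σ).charpoly =
        X ^ 2 - C ((W.psUntwistedTrace : ℤ) : ℚ_[ℓ]) * X + C (3 : ℚ_[ℓ]) := by
  classical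
  haveI : NeZero ((9 : ℕ) : ℚ) := ⟨by norm_num⟩
  have hζ := IsCyclotomicExtension.zeta_spec 9 ℚ F
  obtain ⟨𝔔, _, w, h𝔔𝔓, h𝔔w, hw3, hw, hv3⟩ := exists_prime_absIntegers_over_three F hv h𝔓
  -- an arithmetic Frobenius of `Γ_F` at `𝔔`
  obtain ⟨σ', hσ'⟩ := HeightOneSpectrum.exists_isArithFrobAt_of_mem_primesAbove_holds h𝔔w
  refine ⟨absGaloisRestrict ℚ F σ', ?_, ?_, ?_⟩
  · -- `res σ'` is an arithmetic Frobenius at `𝔓` (same residue field `𝔽₃`)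
    rw [HeightOneSpectrum.isArithFrobAt_iff_of_mem_primesAbove h𝔓, hv3, ← h𝔔𝔓,
      forall_smul_sub_pow_mem_comap_iff]
    rw [HeightOneSpectrum.isArithFrobAt_iff_of_mem_primesAbove h𝔔w, hw] at hσ'
    exact hσ'
  · -- `res σ'` fixes `ζ₉`
    have ht : IsPrimitiveRoot (absEmbedding ℚ F (zeta 9 ℚ F)) 9 :=
      hζ.map_of_injective (absEmbedding ℚ F).injective
    apply Units.ext
    rw [Units.val_one, ← Nat.cast_one]
    refine modNCyclotomicCharacter_eq_of_smul_eq_pow ℚ 9 ht _ ?_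
    rw [pow_one]
    exact absGaloisRestrict_smul_absEmbedding ℚ F σ' _
  · -- characteristic polynomial: transport from `V_ℓ(W ×_ℚ F)` at the good place `w`
    have hℓw : (ℓ : 𝓞 F) ∉ w.asIdeal := by
      intro hmem
      have hcop : Nat.Coprime ℓ 3 := (Nat.coprime_primes Fact.out Nat.prime_three).mpr hℓ
      obtain ⟨a, b, hab⟩ := Nat.Coprime.isCoprime hcop
      apply w.isPrime.ne_top
      rw [Ideal.eq_top_iff_one]
      have h1 : (a : 𝓞 F) * (ℓ : 𝓞 F) + (b : 𝓞 F) * (3 : 𝓞 F) ∈ w.asIdeal :=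
        w.asIdeal.add_mem (w.asIdeal.mul_mem_left _ hmem) (w.asIdeal.mul_mem_left _ hw3)
      have h2 : (a : 𝓞 F) * (ℓ : 𝓞 F) + (b : 𝓞 F) * (3 : 𝓞 F) = 1 := by
        have h := congrArg (Int.cast : ℤ → 𝓞 F) hab
        push_cast at h
        exact h
      rwa [h2] at h1
    have hgood := GNineFrobeniusTrace.hasGoodReductionAt_baseChange_of_psRow W hO6 hev hsq F w hw3
    have haw := GNineFrobeniusTrace.frobeniusTraceAt_baseChange_eq_psUntwistedTrace W hO6 hev hsq F w hw3
    have hcF := (W.baseChange F).continuous_rationalGaloisRepTate_holds ℓ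
    haveI := (W.baseChange F).module_finite_rationalTateModule_holds ℓ
    have hcp := (W.baseChange F).hasFrobCharpolyAt_rationalTateGaloisRepOf_of_hasGoodReductionAt
      ((W.baseChange F).trace_galoisRepTate_frobenius_of_hasGoodReductionAt_holds ℓ)
      ((W.baseChange F).det_galoisRepTate_frobenius_of_hasGoodReductionAt_holds ℓ) hcF hℓw hgood
      𝔔 h𝔔w σ' hσ'
    rw [NumberField.natCard_residueField_adicCompletionIntegers_eq_residueCard, hw, haw] at hcp
    -- `ρ_F(σ') = e ∘ ρ(res σ') ∘ e⁻¹`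
    have hconj : (W.baseChange F).rationalGaloisRepTate ℓ σ' =
        (rationalTateModuleEquiv W F ℓ).conj (W.rationalGaloisRepTate ℓ (absGaloisRestrict ℚ F σ')) := by
      refine LinearMap.ext fun x => ?_
      rw [LinearEquiv.conj_apply_apply, rationalTateModuleEquiv_rationalGaloisRepTate,
        LinearEquiv.apply_symm_apply]
    rw [← LinearEquiv.charpoly_conj (rationalTateModuleEquiv W F ℓ), ← hconj]
    simp only [Nat.cast_ofNat] at hcp
    exact hcp

/-- **An arithmetic Frobenius at `𝔓 ∣ 3` fixing `ζ₉` with characteristic polynomial `X² − a_w(W)X + 3` on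
`V_ℓ(W)`**, principal-series rows, `ℓ ≠ 3`. [cite: SilvermanAEC2009, V.2.3.1 and C.§16] [cite: SerreTate1968, §1] -/
theorem exists_isArithFrobAt_charpoly_rationalGaloisRepTate
    (hO6 : ClassO6 W 3) (hev : Even (padicValInt 3 W.minimalDiscriminantInt))
    (hsq : W.minimalDiscriminantInt / 3 ^ padicValInt 3 W.minimalDiscriminantInt % 3 = 1)
    (ℓ : ℕ) [Fact ℓ.Prime] (hℓ : ℓ ≠ 3) [Module.Finite ℚ_[ℓ] (W.rationalTateModule ℓ)]
    {v : HeightOneSpectrum (𝓞 ℚ)} (hv : (3 : 𝓞 ℚ) ∈ v.asIdeal)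
    {𝔓 : Ideal (absIntegers (𝓞 ℚ) ℚ)} (h𝔓 : 𝔓 ∈ v.primesAbove) :
    ∃ σ : absoluteGaloisGroup ℚ, IsArithFrobAt (𝓞 ℚ) σ 𝔓 ∧ modNCyclotomicCharacter ℚ 9 σ = 1 ∧
      (W.rationalGaloisRepTate ℓ σ).charpoly =
        X ^ 2 - C ((W.psUntwistedTrace : ℤ) : ℚ_[ℓ]) * X + C (3 : ℚ_[ℓ]) := by
  haveI : NeZero ((9 : ℕ) : ℚ) := ⟨by norm_num⟩
  haveI hcyc : IsCyclotomicExtension {9} ℚ (CyclotomicField 9 ℚ) := by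
    have h : (CyclotomicField.algebra 9 ℚ : Algebra ℚ (CyclotomicField 9 ℚ)) =
        DivisionRing.toRatAlgebra :=
      Subsingleton.elim _ _
    exact h ▸ CyclotomicField.isCyclotomicExtension 9 ℚ
  haveI : NumberField (CyclotomicField 9 ℚ) := IsCyclotomicExtension.numberField {9} ℚ _
  exact exists_isArithFrobAt_charpoly_rationalGaloisRepTate_aux W (CyclotomicField 9 ℚ) hO6 hev hsq ℓ hℓ
    hv h𝔓

end Summit.BirchSwinnertonDyer.BirchSwinnertonDyer.Theorems.InertiaOverCyclotomicNine

end
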